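import Literature.MathematicalPhysics.QuantumFieldTheory.Balaban1983to89.B12Eq44Space
import Literature.MathematicalPhysics.QuantumFieldTheory.Balaban1983to89.B12Repr43

/-!
# `Balaban1983to89.B12Eq44Ball` — T. Bałaban, *Renormalization group approach to lattice gauge field theories. I*,
Commun. Math. Phys. **109** (1987) 249–301 [Balaban1987RG1], p. 281 (4.4): **«… Thus it is defined and analytic on the space
of configurations 𝐀 satisfying max{|𝐀|_X, |P₁(□₀)𝐀|_X, |∇^ξ𝐀|_X, |Δ^ξ𝐀|_X} < α₂. (4.4)» — PART 3: THE (4.4)-SET IS THE OPEN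
`α₂`-BALL OF A NORMED CONFIGURATION SPACE.**  The (4.4)-functional `max{|𝐀|, |∇^ξ𝐀|, |Δ^ξ𝐀|, |P₁𝐀|}` is a seminorm dominating
the sup norm (`seminorm44`, `norm_le_seminorm44`), the (4.4)-set of `B12Eq44Space` is its open ball (`seminorm44_lt_iff`), the
`𝔤ᶜ`-valued Landau-gauge configurations re-normed by it form a complex normed space (`Cfg44`, via `NormedSpace.Core`), and the
sentence of PART 2 (`B12Eq44Space.analyticOnNhd_E_sub310_one`: `𝐀 ↦ E^{(j)}(X, exp iξ𝐀)` analytic at the points of the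
(4.4)-set) becomes ANALYTICITY ON THE OPEN BALL `{‖𝐀‖₍₄.₄₎ < α₂}` (`analyticOnNhd_E_sub310_one_ball`) — letter for letter the
hypothesis `hf : AnalyticOnNhd ℂ f U`, `hball : ball 0 α₂ ⊆ U`, `hU : IsOpen U` under which the surge unit `b2b-balaban-pv12`
kernel-checked (4.3) ⇒ (4.5) over «an ABSTRACT complex normed space E (the configurations, ‖·‖ = the (4.4) max-functional, taken
as a norm)» (`B12Repr43.norm_iteratedFDeriv_comp_le`/`ineq45_of_functions`; pub-balaban DIVERGENCE D-pv12.3/D-pv12.6); §6 performs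
that instantiation (`norm_iteratedFDeriv_E_sub310_one_comp_le`).

HONEST FRAMING (cell `lit-balaban`, verbatim): statement-level skeleton of published theorems with citation tags; proofs where landed; nothing here is a claim about the Yang–Mills mass gap.

PDF held: `paper:balaban1987-cmp109-rg-i-small-field` (journal page = PDF page + 248); pp. 281–282 [PDF 33–34] re-read by this
unit from the text layer (the letter `|P₁(□₀)𝐀|_X` after the render-based quotation in `B12Repr43`).  THE PRINT, p. 281 [33]:
*«… Thus it is defined and analytic on the space of configurations 𝐀 satisfying max{…} < α₂. (4.4) We have also the bounds (1.18)
for this function.»*; p. 282 [34]: *«The norm in (4.4) of the expression … can be estimated by B₃ Π_{i∈N(p)} |𝐁_i| … Using (4.3)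
and the last remarks we obtain (4.5)»* — the print USES (4.4) as holomorphy on a ball of radius `α₂` in the norm `max{…}` plus
Cauchy estimates; this module supplies that ball.

WHAT IS REPRODUCED (SKELETON row `B12.Eq4.4`; owners r09/r20; referee ref-5 — PART 3 after `B12Eq44Analytic` p299445 and
`B12Eq44Space` p299941; and the KNITTING of that row to rows `B12.Eq4.2-4.3`/`B12.Eq4.5`, whose kernels `B12Repr43`/`B12Ineq45`
are typed over the abstract (4.4)-normed space).  Carriers OF RECORD, BY NAME: `Setup` bonds/sites; the letters
`B12RegularSpaces111.grad` (∇^ξ), `B9Eq352ScalarFluct.siteLap` (Δ^ξ), `B9Eq3117Current.covDη`/`B9Eq39Adjoint.divB`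
(P₁ = D^ξ P ξ⁻¹D^{ξ*}) at the flat background exactly as in `B12Eq313JSlot`/`B12Eq44Space.space44`; `B12RegularSpaces111.space′`;
`B12Eq311CurrentExpansion.sub310`; `B12Eq18Current.ofBackground`; Mathlib's `Seminorm`, `NormedSpace.Core`, `AnalyticOnNhd`;
`B12Repr43.blockIns`/`norm_iteratedFDeriv_comp_le`.
* §1 `gradL`, `siteLapL`, `divL`, `covDηL`, `p1L` — the four letters of (4.4) are ℂ-linear in `𝐀` (`R`, `P` ℂ-linear).
* §2 `seminorm44 π P ξ := |𝐀| ⊔ sup|∇^ξ𝐀| ⊔ sup|πΔ^ξ𝐀| ⊔ sup|πP₁𝐀|`; `norm_le_seminorm44`; **`seminorm44_lt_iff`** (`↔ 𝐀 ∈ space44`).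
* §3 `Cfg44 π P ξ S` (the subspace `S` normed by `seminorm44`; `Cfg44.core`), `Cfg44.incl : Cfg44 →L[ℂ] (bonds → 𝔸)`,
  **`Cfg44.mem_ball_zero_iff`** (`w ∈ ball 0 α₂ ↔ w.val ∈ space44`); §4 **`Cfg44.analyticOnNhd_comp_incl`** (transfer to the ball).
* §5 `landauSub 𝓜 R ξ` (`𝔤ᶜ`-valued, `R(ξ⁻¹D^{ξ*}𝐀) = 0`) and **`analyticOnNhd_E_sub310_one_ball`**; §6 **`norm_iteratedFDeriv_E_sub310_one_comp_le`**
  — `B12Repr43.norm_iteratedFDeriv_comp_le` with `U := ball 0 α₂`, `hU`/`hball`/`hf` DISCHARGED: the (4.5)-type bound for `Dⁿ(E^{(j)} ∘ 𝐇)(0)`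
  from the remaining printed inputs only ((1.18) on the ball, `𝐇` of class `Cⁿ` at `0` with `𝐇(0) = 0`, the p. 282 block bounds, `2B₃ ≥ α₂`).

THE READING (located; nothing weakened silently).  (a)–(e) of `B12Eq44Space` stand.  (f) NEW: `R`, `P` are ℂ-LINEAR maps of site
fields (PART 2: arbitrary maps with `R + P = id`); linearity makes `|P₁𝐀|` a seminorm and the Landau gauge a subspace — both
operators of [15] (180) are linear.  (g) The (4.4)-functional is a norm on the finite torus because it dominates `|𝐀|`; no
equivalence of norms is needed or claimed (the inclusion is continuous; the ball is open in the (4.4)-norm by definition).  NOT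
here: (4.2), the identification of `𝐇_j(□₀, ·)` and of the p. 282 block bounds (rows `B12.Eq4.2-4.3`, `B12.Eq4.5`), (1.18).
Unit `lit-balaban-p05` (Phase-2 seat p05 gen 7; free-target protocol G.5-34(d); TAKING line HOME/STATUS.md 2026-08-21T19:04:28Z).
-/

namespace Literature.MathematicalPhysics.QuantumFieldTheory.Balaban1983to89.B12Eq44Ball

open Literature.MathematicalPhysics.QuantumFieldTheory.Balaban1983to89
open Literature.MathematicalPhysics.QuantumFieldTheory.Balaban1983to89.B9Eq39Adjoint
open Literature.MathematicalPhysics.QuantumFieldTheory.Balaban1983to89.B9TorusCalculus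
open Literature.MathematicalPhysics.QuantumFieldTheory.Balaban1983to89.B9Eq352ScalarFluct (siteLap)
open Literature.MathematicalPhysics.QuantumFieldTheory.Balaban1983to89.B9Eq3117Current (covDη covDη_apply divB_smul)
open Literature.MathematicalPhysics.QuantumFieldTheory.Balaban1983to89.B12RegularSpaces111
open Literature.MathematicalPhysics.QuantumFieldTheory.Balaban1983to89.B12Eq18Current
open Literature.MathematicalPhysics.QuantumFieldTheory.Balaban1983to89.B12Eq311CurrentExpansion
open Literature.MathematicalPhysics.QuantumFieldTheory.Balaban1983to89.B12Eq44Space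

noncomputable section

variable {P : Params} {i : ℕ} {𝔸 : Type*} [NormedRing 𝔸] [NormedAlgebra ℂ 𝔸]

/-! ## §1. The four letters of (4.4) as ℂ-linear maps of the configuration `𝐀` -/

section Letters

variable (ξ : ℝ)

omit [NormedAlgebra ℂ 𝔸] in
/-- `D¹_μ` of `B9Eq39Adjoint` is additive as a map of site functions. [folklore] -/
private theorem covD_add_fun {S ι : Type*} (T : ι → Equiv.Perm S) (U : ι → S → 𝔸ˣ) (μ : ι) (f g : S → 𝔸) :
    covD T U μ (f + g) = covD T U μ f + covD T U μ g :=
  funext (covD_add T U μ f g)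

/-- `D¹_μ` commutes with scalars as a map of site functions. [folklore] -/
private theorem covD_smul_fun {S ι : Type*} (T : ι → Equiv.Perm S) (U : ι → S → 𝔸ˣ) (c : ℂ) (μ : ι) (f : S → 𝔸) :
    covD T U μ (c • f) = c • covD T U μ f :=
  funext (covD_smul T U c μ f)

/-- `Δ^η_U` ((3.23) of [B9], `B9Eq352ScalarFluct.siteLap`) is additive. [folklore] -/
private theorem siteLap_add {S ι : Type*} [Fintype ι] (T : ι → Equiv.Perm S) (U : ι → S → 𝔸ˣ) (η : ℝ)
    (f g : S → 𝔸) (x : S) : siteLap T U η (f + g) x = siteLap T U η f x + siteLap T U η g x := by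
  simp only [siteLap, covD_add_fun, covDstar_add, Finset.sum_add_distrib, smul_add]

/-- `Δ^η_U` commutes with scalars. [folklore] -/
private theorem siteLap_smul {S ι : Type*} [Fintype ι] (T : ι → Equiv.Perm S) (U : ι → S → 𝔸ˣ) (η : ℝ) (c : ℂ)
    (f : S → 𝔸) (x : S) : siteLap T U η (c • f) x = c • siteLap T U η f x := by
  simp only [siteLap, covD_smul_fun, covDstar_smul, ← Finset.smul_sum, smul_comm c]

omit [NormedAlgebra ℂ 𝔸] in
/-- `D*` ((3.8) of [B9], `divB`) is additive in the bond field. [folklore] -/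
private theorem divB_add {S ι : Type*} [Fintype ι] (T : ι → Equiv.Perm S) (U : ι → S → 𝔸ˣ) (A B : ι → S → 𝔸)
    (x : S) : divB T U (A + B) x = divB T U A x + divB T U B x := by
  simp only [divB, Pi.add_apply, covDstar_add, Finset.sum_add_distrib]

/-- **`𝐀 ↦ (∇^ξ_μ 𝐀_ν)(x)`** (the flat `ξ`-derivative (1.12), `B12RegularSpaces111.grad`) is ℂ-linear.
[cite: Balaban1987RG1, (1.12) p.262] -/
def gradL (μ ν : Fin P.d) (x : Site P i) : (PBond P i → 𝔸) →ₗ[ℂ] 𝔸 where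
  toFun A := grad ξ μ (fun y => A ⟨y, ν⟩) x
  map_add' A B := by
    simp only [grad, Pi.add_apply, ← smul_add]
    congr 1
    abel
  map_smul' c A := by
    simp only [grad, Pi.smul_apply, RingHom.id_apply, ← smul_sub, smul_comm c]

/-- Unfolding `gradL`. [cite: Balaban1987RG1, (1.12) p.262] -/
@[simp] theorem gradL_apply (μ ν : Fin P.d) (x : Site P i) (A : PBond P i → 𝔸) :
    gradL ξ μ ν x A = grad ξ μ (fun y => A ⟨y, ν⟩) x := rfl

/-- **`𝐀 ↦ (Δ^ξ𝐀_μ)(x)`** at the flat background (`B9Eq352ScalarFluct.siteLap` of the component `𝐀_μ`, the letter `|Δ^ξ𝐀|`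
of (4.4) as in `B12Eq313JSlot`) is ℂ-linear. [cite: Balaban1987RG1, (4.4) p.281] -/
def siteLapL (b : PBond P i) : (PBond P i → 𝔸) →ₗ[ℂ] 𝔸 where
  toFun A := siteLap (torusT P i) (dirForm (1 : PBond P i → 𝔸ˣ)) ξ (dirForm A b.dir) b.src
  map_add' A B := siteLap_add _ _ ξ (dirForm A b.dir) (dirForm B b.dir) b.src
  map_smul' c A := siteLap_smul _ _ ξ c (dirForm A b.dir) b.src

/-- Unfolding `siteLapL`. [cite: Balaban1987RG1, (4.4) p.281] -/
@[simp] theorem siteLapL_apply (b : PBond P i) (A : PBond P i → 𝔸) :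
    siteLapL ξ b A = siteLap (torusT P i) (dirForm (1 : PBond P i → 𝔸ˣ)) ξ (dirForm A b.dir) b.src := rfl

/-- **`𝐀 ↦ ξ⁻¹D^{ξ*}𝐀`** (the site divergence (3.8) of [B9] at the flat background, with its `ξ⁻¹`) is ℂ-linear.
[cite: Balaban1987RG1, (3.11)-(3.13) p.272] -/
def divL : (PBond P i → 𝔸) →ₗ[ℂ] (Site P i → 𝔸) where
  toFun A := fun y => ((ξ : ℂ)⁻¹) • divB (torusT P i) (dirForm (1 : PBond P i → 𝔸ˣ)) (dirForm A) y
  map_add' A B := by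
    funext y
    simp only [Pi.add_apply, ← smul_add, ← divB_add]
    rfl
  map_smul' c A := by
    funext y
    simp only [Pi.smul_apply, RingHom.id_apply]
    rw [smul_comm c, ← divB_smul (c := c) (B := dirForm A)]
    rfl

/-- Unfolding `divL`. [cite: Balaban1987RG1, (3.11)-(3.13) p.272] -/
@[simp] theorem divL_apply (A : PBond P i → 𝔸) :
    divL (P := P) (i := i) ξ A = fun y => ((ξ : ℂ)⁻¹) • divB (torusT P i) (dirForm (1 : PBond P i → 𝔸ˣ)) (dirForm A) y := rfl

/-- **`λ ↦ (D^ξ λ)_μ(x)`** (the covariant gradient (3.3) of [B9] at the flat background, `B9Eq3117Current.covDη`) is ℂ-linear.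
[cite: Balaban1987RG1, (3.11)-(3.13) p.272] -/
def covDηL (μ : Fin P.d) (x : Site P i) : (Site P i → 𝔸) →ₗ[ℂ] 𝔸 where
  toFun lam := covDη (torusT P i) (dirForm (1 : PBond P i → 𝔸ˣ)) ξ lam μ x
  map_add' f g := by
    simp only [covDη_apply, covD_add, smul_add]
  map_smul' c f := by
    simp only [covDη_apply, covD_smul, RingHom.id_apply, smul_comm c]

/-- Unfolding `covDηL`. [cite: Balaban1987RG1, (3.11)-(3.13) p.272] -/
@[simp] theorem covDηL_apply (μ : Fin P.d) (x : Site P i) (lam : Site P i → 𝔸) :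
    covDηL ξ μ x lam = covDη (torusT P i) (dirForm (1 : PBond P i → 𝔸ˣ)) ξ lam μ x := rfl

/-- **`𝐀 ↦ π(P₁𝐀)(b) = π(D^ξ P ξ⁻¹D^{ξ*}𝐀)_μ(x)`** (the letter `|P₁𝐀|` of (4.4)/(3.14) as in `B12Eq313JSlot`, `P` a ℂ-linear map of
site fields) is ℂ-linear. [cite: Balaban1987RG1, (4.4) p.281, (3.13) p.272] -/
def p1L (π : 𝔸 →ₗ[ℂ] 𝔸) (Pop : (Site P i → 𝔸) →ₗ[ℂ] (Site P i → 𝔸)) (b : PBond P i) : (PBond P i → 𝔸) →ₗ[ℂ] 𝔸 :=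
  π ∘ₗ covDηL ξ b.dir b.src ∘ₗ Pop ∘ₗ divL ξ

/-- Unfolding `p1L`. [cite: Balaban1987RG1, (4.4) p.281] -/
@[simp] theorem p1L_apply (π : 𝔸 →ₗ[ℂ] 𝔸) (Pop : (Site P i → 𝔸) →ₗ[ℂ] (Site P i → 𝔸)) (b : PBond P i)
    (A : PBond P i → 𝔸) :
    p1L ξ π Pop b A = π (covDη (torusT P i) (dirForm (1 : PBond P i → 𝔸ˣ)) ξ
      (Pop (fun y => ((ξ : ℂ)⁻¹) • divB (torusT P i) (dirForm (1 : PBond P i → 𝔸ˣ)) (dirForm A) y)) b.dir b.src) :=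
  rfl

end Letters

/-! ## §2. The (4.4)-functional `max{|𝐀|, |∇^ξ𝐀|, |Δ^ξ𝐀|, |P₁𝐀|}` as a seminorm; the (4.4)-set is its open `α₂`-ball -/

section Functional

variable (π : 𝔸 →ₗ[ℂ] 𝔸) (Pop : (Site P i → 𝔸) →ₗ[ℂ] (Site P i → 𝔸)) (ξ : ℝ)

/-- **The (4.4)-functional** `𝐀 ↦ max{|𝐀|, |∇^ξ𝐀|, |Δ^ξ𝐀|, |P₁𝐀|}` (sup norms over the finite torus; letters as in
`B12Eq44Space.space44`) — a seminorm on the configurations, `≥` the sup norm `|𝐀|`, hence a norm (`norm_le_seminorm44`).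
[cite: Balaban1987RG1, (4.4) p.281] -/
def seminorm44 : Seminorm ℂ (PBond P i → 𝔸) :=
  normSeminorm ℂ (PBond P i → 𝔸) ⊔
    (Finset.univ.sup fun q : (Fin P.d × Fin P.d) × Site P i => (normSeminorm ℂ 𝔸).comp (gradL ξ q.1.1 q.1.2 q.2)) ⊔
    (Finset.univ.sup fun b : PBond P i => (normSeminorm ℂ 𝔸).comp (π ∘ₗ siteLapL ξ b)) ⊔
    (Finset.univ.sup fun b : PBond P i => (normSeminorm ℂ 𝔸).comp (p1L ξ π Pop b))

/-- `|𝐀| ≤ max{|𝐀|, …}`: the (4.4)-functional dominates the sup norm. [cite: Balaban1987RG1, (4.4) p.281] -/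
theorem norm_le_seminorm44 (A : PBond P i → 𝔸) : ‖A‖ ≤ seminorm44 π Pop ξ A := by
  have h : normSeminorm ℂ (PBond P i → 𝔸) ≤ seminorm44 π Pop ξ := le_sup_left.trans (le_sup_left.trans le_sup_left)
  exact h A

/-- A finite `sup` of seminorms is `< a` iff every member is (`0 < a`). [folklore] -/
private theorem finset_sup_apply_lt_iff {ι E : Type*} [AddCommGroup E] [Module ℂ E] {p : ι → Seminorm ℂ E}
    {s : Finset ι} {x : E} {a : ℝ} (ha : 0 < a) : s.sup p x < a ↔ ∀ j ∈ s, p j x < a :=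
  ⟨fun h _ hj => (Seminorm.le_finset_sup_apply hj).trans_lt h, Seminorm.finset_sup_apply_lt ha⟩

/-- **The (4.4)-set is the open `α₂`-ball of the (4.4)-functional**: `max{|𝐀|, |∇^ξ𝐀|, |Δ^ξ𝐀|, |P₁𝐀|} < α₂ ↔ 𝐀 ∈ space44`
(`0 < α₂`). [cite: Balaban1987RG1, (4.4) p.281] -/
theorem seminorm44_lt_iff {α₂ : ℝ} (hα : 0 < α₂) (A : PBond P i → 𝔸) :
    seminorm44 π Pop ξ A < α₂ ↔ A ∈ space44 π Pop ξ α₂ := by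
  simp only [seminorm44, Seminorm.sup_apply, sup_lt_iff, finset_sup_apply_lt_iff hα, Finset.mem_univ, true_implies,
    Seminorm.comp_apply, coe_normSeminorm, LinearMap.comp_apply, gradL_apply, siteLapL_apply, p1L_apply,
    pi_norm_lt_iff hα, Prod.forall, mem_space44_iff, and_assoc]

/-- Membership in the ball form. [cite: Balaban1987RG1, (4.4) p.281] -/
theorem ball_seminorm44_eq {α₂ : ℝ} (hα : 0 < α₂) : (seminorm44 π Pop ξ).ball 0 α₂ = space44 π Pop ξ α₂ :=
  Set.ext fun A => by rw [Seminorm.mem_ball_zero, seminorm44_lt_iff π Pop ξ hα]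

end Functional

/-! ## §3. The (4.4)-normed configuration space: a subspace of configurations with `‖𝐀‖ := max{|𝐀|, |∇^ξ𝐀|, |Δ^ξ𝐀|, |P₁𝐀|}` -/

section Carrier

variable (π : 𝔸 →ₗ[ℂ] 𝔸) (Pop : (Site P i → 𝔸) →ₗ[ℂ] (Site P i → 𝔸)) (ξ : ℝ) (S : Submodule ℂ (PBond P i → 𝔸))

/-- **The (4.4)-normed configuration space** over a ℂ-subspace `S` of configurations (type synonym of `↥S`; its norm is the
(4.4)-functional, NOT the sup norm of the ambient function space): the complex normed space `E` «of configurations 𝐇 with the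
(4.4)-functional as norm» over which `B12Repr43`/`B12Ineq45` type (4.3)–(4.5). [cite: Balaban1987RG1, (4.4) p.281] -/
def Cfg44 (_π : 𝔸 →ₗ[ℂ] 𝔸) (_Pop : (Site P i → 𝔸) →ₗ[ℂ] (Site P i → 𝔸)) (_ξ : ℝ) (S : Submodule ℂ (PBond P i → 𝔸)) :
    Type _ := S

namespace Cfg44

/-- The additive group of the subspace `S`. [cite: Balaban1987RG1, (4.4) p.281] -/
instance : AddCommGroup (Cfg44 π Pop ξ S) := inferInstanceAs (AddCommGroup S)
/-- The ℂ-module structure of the subspace `S`. [cite: Balaban1987RG1, (4.4) p.281] -/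
instance : Module ℂ (Cfg44 π Pop ξ S) := inferInstanceAs (Module ℂ S)

variable {π Pop ξ S}

/-- The underlying configuration `𝐀 : bonds → 𝔸`. [cite: Balaban1987RG1, (4.4) p.281] -/
def val (w : Cfg44 π Pop ξ S) : PBond P i → 𝔸 := Subtype.val (p := fun A => A ∈ S) w

/-- The underlying configuration lies in `S`. [cite: Balaban1987RG1, (4.4) p.281] -/
theorem val_mem (w : Cfg44 π Pop ξ S) : w.val ∈ S := Subtype.property (p := fun A => A ∈ S) w

/-- `val` is injective. [folklore] -/
private theorem val_injective : Function.Injective (val (π := π) (Pop := Pop) (ξ := ξ) (S := S)) :=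
  Subtype.val_injective

/-- `val (w + w′) = val w + val w′`. [folklore] -/
private theorem val_add (w w' : Cfg44 π Pop ξ S) : (w + w').val = w.val + w'.val := rfl
/-- `val (c • w) = c • val w`. [folklore] -/
private theorem val_smul (c : ℂ) (w : Cfg44 π Pop ξ S) : (c • w).val = c • w.val := rfl
/-- `val 0 = 0`. [folklore] -/
private theorem val_zero : (0 : Cfg44 π Pop ξ S).val = 0 := rfl

/-- A configuration of `S` as a point of the (4.4)-normed space. [cite: Balaban1987RG1, (4.4) p.281] -/
def mk (A : PBond P i → 𝔸) (hA : A ∈ S) : Cfg44 π Pop ξ S := (⟨A, hA⟩ : S)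

/-- `val (mk A) = A`. [cite: Balaban1987RG1, (4.4) p.281] -/
@[simp] theorem val_mk (A : PBond P i → 𝔸) (hA : A ∈ S) : (mk A hA : Cfg44 π Pop ξ S).val = A := rfl

/-- **The norm of the (4.4)-space is the (4.4)-functional** `‖𝐀‖ = max{|𝐀|, |∇^ξ𝐀|, |Δ^ξ𝐀|, |P₁𝐀|}`.
[cite: Balaban1987RG1, (4.4) p.281] -/
instance : Norm (Cfg44 π Pop ξ S) := ⟨fun w => seminorm44 π Pop ξ w.val⟩

/-- Unfolding the norm. [cite: Balaban1987RG1, (4.4) p.281] -/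
theorem norm_def (w : Cfg44 π Pop ξ S) : ‖w‖ = seminorm44 π Pop ξ w.val := rfl

/-- The (4.4)-functional is a norm on `S` (it dominates the sup norm): the normed-space axioms. [cite: Balaban1987RG1, (4.4) p.281] -/
theorem core : NormedSpace.Core ℂ (Cfg44 π Pop ξ S) where
  norm_nonneg w := apply_nonneg (seminorm44 π Pop ξ) w.val
  norm_smul c w := by
    rw [norm_def, norm_def, val_smul, map_smul_eq_mul]
  norm_triangle w w' := by
    rw [norm_def, norm_def, norm_def, val_add]
    exact map_add_le_add _ _ _
  norm_eq_zero_iff w := by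
    refine ⟨fun h => ?_, fun h => by rw [h, norm_def, val_zero, map_zero]⟩
    have h0 : w.val = 0 := norm_le_zero_iff.1 ((norm_le_seminorm44 π Pop ξ w.val).trans_eq h)
    exact val_injective (h0.trans val_zero.symm)

/-- The (4.4)-normed space is a normed additive group. [cite: Balaban1987RG1, (4.4) p.281] -/
instance : NormedAddCommGroup (Cfg44 π Pop ξ S) := NormedAddCommGroup.ofCore core
/-- The (4.4)-normed space is a complex normed space. [cite: Balaban1987RG1, (4.4) p.281] -/
instance : NormedSpace ℂ (Cfg44 π Pop ξ S) := NormedSpace.ofCore core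

/-- `|𝐀| ≤ ‖𝐀‖₍₄.₄₎`. [cite: Balaban1987RG1, (4.4) p.281] -/
theorem norm_val_le (w : Cfg44 π Pop ξ S) : ‖w.val‖ ≤ ‖w‖ := norm_le_seminorm44 π Pop ξ w.val

variable (π Pop ξ S) in
/-- **The inclusion** of the (4.4)-normed space into the configurations with the sup norm, a continuous linear map (of norm `≤ 1`).
[cite: Balaban1987RG1, (4.4) p.281] -/
def incl : Cfg44 π Pop ξ S →L[ℂ] (PBond P i → 𝔸) :=
  LinearMap.mkContinuous { toFun := val, map_add' := val_add, map_smul' := val_smul } 1 fun w => by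
    rw [one_mul]; exact norm_val_le w

/-- `incl w = val w`. [cite: Balaban1987RG1, (4.4) p.281] -/
@[simp] theorem incl_apply (w : Cfg44 π Pop ξ S) : incl π Pop ξ S w = w.val := rfl

/-- **The open `α₂`-ball of the (4.4)-normed space is the (4.4)-set** (intersected with `S`): `‖𝐀‖ < α₂ ↔ 𝐀 ∈ space44` (`0 < α₂`).
[cite: Balaban1987RG1, (4.4) p.281] -/
theorem mem_ball_zero_iff {α₂ : ℝ} (hα : 0 < α₂) (w : Cfg44 π Pop ξ S) :
    w ∈ Metric.ball (0 : Cfg44 π Pop ξ S) α₂ ↔ w.val ∈ space44 π Pop ξ α₂ := by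
  rw [_root_.mem_ball_zero_iff, norm_def, seminorm44_lt_iff π Pop ξ hα]

/-! ## §4. Transfer: analytic at the points of the (4.4)-set ⇒ analytic on the open ball of the (4.4)-normed space -/

/-- **Transfer of analyticity to the (4.4)-normed carrier.**  If `f` (on configurations with the sup norm) is analytic at every
point of `space44 ∩ S`, then `f ∘ incl` is analytic on the OPEN ball `{‖𝐀‖₍₄.₄₎ < α₂}` of the (4.4)-normed space over `S` — the
hypothesis shape `hf : AnalyticOnNhd ℂ f U`, `hball : ball 0 α₂ ⊆ U` (`U := ball 0 α₂`) of `B12Repr43.norm_iteratedFDeriv_comp_le` /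
`ineq45_of_functions`. [cite: Balaban1987RG1, (4.4) p.281] -/
theorem analyticOnNhd_comp_incl {V : Type*} [NormedAddCommGroup V] [NormedSpace ℂ V] {α₂ : ℝ} (hα : 0 < α₂)
    {f : (PBond P i → 𝔸) → V} (hf : AnalyticOnNhd ℂ f (space44 π Pop ξ α₂ ∩ (S : Set (PBond P i → 𝔸)))) :
    AnalyticOnNhd ℂ (f ∘ incl π Pop ξ S) (Metric.ball (0 : Cfg44 π Pop ξ S) α₂) := fun w hw =>
  (hf (incl π Pop ξ S w) ⟨(mem_ball_zero_iff hα w).1 hw, w.val_mem⟩).comp ((incl π Pop ξ S).analyticAt w)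

end Cfg44

end Carrier

/-! ## §5. [B12 (4.4)] on the (4.4)-normed carrier: `𝐀 ↦ E^{(j)}(X, exp iξ𝐀)` is analytic on the open ball `{‖𝐀‖₍₄.₄₎ < α₂}` -/

section Ball

variable [CompleteSpace 𝔸] [NormOneClass 𝔸]

/-- **The `𝔤ᶜ`-valued Landau-gauge configurations** `{𝐀 : 𝐀(b) ∈ 𝔤ᶜ ∀ b, R(ξ⁻¹D^{ξ*}𝐀) = 0}` — a ℂ-subspace (`R` a ℂ-linear map of site
fields; the configurations `𝐇_j(□₀, 𝐁)` of (4.2)–(4.3) lie in it by (180) of [15], p. 272). [cite: Balaban1987RG1, p.272, (4.2) p.281] -/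
def landauSub (𝓜 : Model 𝔸) (Rop : (Site P i → 𝔸) →ₗ[ℂ] (Site P i → 𝔸)) (ξ : ℝ) : Submodule ℂ (PBond P i → 𝔸) :=
  Submodule.pi Set.univ (fun _ : PBond P i => 𝓜.gc) ⊓ LinearMap.ker (Rop ∘ₗ divL ξ)

omit [CompleteSpace 𝔸] [NormOneClass 𝔸] in
/-- Membership in `landauSub`, unfolded. [cite: Balaban1987RG1, p.272] -/
theorem mem_landauSub_iff (𝓜 : Model 𝔸) (Rop : (Site P i → 𝔸) →ₗ[ℂ] (Site P i → 𝔸)) (ξ : ℝ) (A : PBond P i → 𝔸) :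
    A ∈ landauSub 𝓜 Rop ξ ↔ (∀ b, A b ∈ 𝓜.gc) ∧
      Rop (fun y => ((ξ : ℂ)⁻¹) • divB (torusT P i) (dirForm (1 : PBond P i → 𝔸ˣ)) (dirForm A) y) = 0 := by
  simp only [landauSub, Submodule.mem_inf, Submodule.mem_pi, Set.mem_univ, true_implies, LinearMap.mem_ker,
    LinearMap.comp_apply, divL_apply]

variable {V : Type*} [NormedAddCommGroup V] [NormedSpace ℂ V]

/-- **[B12 (4.4)] «defined and analytic on the space of configurations 𝐀 satisfying max{|𝐀|_X, |P₁(□₀)𝐀|_X, |∇^ξ𝐀|_X, |Δ^ξ𝐀|_X} < α₂»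
AS ANALYTICITY ON AN OPEN BALL OF A NORMED SPACE**: under the hypotheses of `B12Eq44Space.analyticOnNhd_E_sub310_one` (`R`, `P` here
ℂ-linear) and `0 < α₂`, `𝐀 ↦ E(exp iξ𝐀, J(exp iξ𝐀))` pulled back to the (4.4)-normed space of `𝔤ᶜ`-valued Landau-gauge configurations
is analytic on the open ball `{‖𝐀‖₍₄.₄₎ < α₂}`. [cite: Balaban1987RG1, (4.4) p.281] -/
theorem analyticOnNhd_E_sub310_one_ball (𝓜 : Model 𝔸) {F : Frame P i 𝔸} {c : StepConsts} {π : 𝔸 →ₗ[ℂ] 𝔸}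
    {Rop Pop : (Site P i → 𝔸) →ₗ[ℂ] (Site P i → 𝔸)} {α₀ α₁ α₂ Cπ : ℝ}
    (hξ : 0 < c.ξ) (hξ1 : c.ξ ≤ 1) (hcB : 0 < c.cB) (hα₀ : 0 < α₀) (hα₀1 : α₀ ≤ 1) (hα₂ : 0 < α₂)
    (hα₂q : α₂ ≤ 1 / 4) (hα₂α₁ : α₂ ≤ α₁) (h8 : 8 * α₂ < α₀) (hCπ : 0 ≤ Cπ) (hπn : ∀ X, ‖π X‖ ≤ Cπ * ‖X‖)
    (hπgc : ∀ X, π X ∈ 𝓜.gc) (hgcAd : ∀ g ∈ 𝓜.Gc, ∀ X ∈ 𝓜.gc, R g X ∈ 𝓜.gc) (heGc : ∀ a ∈ 𝓜.gc, expI c.ξ a ∈ 𝓜.Gc)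
    (hRP : ∀ f : Site P i → 𝔸, Rop f + Pop f = f)
    (hres : (2 + (P.d - 1) * (Cπ * (C311 1 + 2 * 1 ^ 14))) * α₂ ≤ α₀)
    (E : (PBond P i → 𝔸) × (PBond P i → 𝔸) → V)
    (hE : ∀ Φ ∈ space' 𝓜 F c α₀ α₁, AnalyticAt ℂ E ((fun b => (Φ.U b : 𝔸)), Φ.J))
    (hIV₁ : CondIV F.bg F.X₂ c α₀ (1 : PBond P i → 𝔸ˣ))
    (hIV : ∀ A ∈ space44 π Pop c.ξ α₂, CondIV F.bg F.X₂ c α₀ (sub310 c.ξ A (1 : PBond P i → 𝔸ˣ))) :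
    AnalyticOnNhd ℂ ((fun A : PBond P i → 𝔸 =>
      E ((fun b => ((ofBackground π c.ξ (sub310 c.ξ A (1 : PBond P i → 𝔸ˣ))).U b : 𝔸)),
        (ofBackground π c.ξ (sub310 c.ξ A (1 : PBond P i → 𝔸ˣ))).J)) ∘ Cfg44.incl π Pop c.ξ (landauSub 𝓜 Rop c.ξ))
      (Metric.ball (0 : Cfg44 π Pop c.ξ (landauSub 𝓜 Rop c.ξ)) α₂) := by
  refine Cfg44.analyticOnNhd_comp_incl hα₂ ((analyticOnNhd_E_sub310_one 𝓜 hξ hξ1 hcB hα₀ hα₀1 hα₂.le hα₂q hα₂α₁ h8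
    hCπ hπn hπgc hgcAd heGc hRP hres E hE hIV₁ hIV).mono ?_)
  rintro A ⟨hA, hS⟩
  exact ⟨hA, (mem_landauSub_iff 𝓜 Rop c.ξ A).1 hS⟩

/-! ## §6. Knitting: the hypotheses `hU`/`hball`/`hf` of pv12's (4.3) ⇒ (4.5) kernel discharged on the concrete carrier -/

variable [CompleteSpace V] {W : Type*} [NormedAddCommGroup W] [NormedSpace ℂ W]

/-- **(4.3) ⇒ (4.5) on the concrete carrier** (`B12Repr43.norm_iteratedFDeriv_comp_le` with `U := {‖𝐀‖₍₄.₄₎ < α₂}`; `hU`, `hball`,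
`hf` DISCHARGED by §5): for `𝐁 ↦ E^{(j)}(X, exp iξ𝐇(𝐁))` ((4.2)), `𝐇 : W → (4.4)-space` `Cⁿ` at `0`, `𝐇(0) = 0`, the remaining printed
inputs ((1.18) on the ball, the p. 282 block bounds, `2B₃ ≥ α₂`) give `‖Dⁿ(E^{(j)} ∘ 𝐇)(0)[𝐁_i]‖ ≤ (2n²B₃/α₂)ⁿ·S·W₀·Π_i ‖𝐁_i‖`.
[cite: Balaban1987RG1, (4.3)–(4.5) pp.281–282] -/
theorem norm_iteratedFDeriv_E_sub310_one_comp_le (𝓜 : Model 𝔸) {F : Frame P i 𝔸} {c : StepConsts} {π : 𝔸 →ₗ[ℂ] 𝔸}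
    {Rop Pop : (Site P i → 𝔸) →ₗ[ℂ] (Site P i → 𝔸)} {α₀ α₁ α₂ Cπ : ℝ}
    (hξ : 0 < c.ξ) (hξ1 : c.ξ ≤ 1) (hcB : 0 < c.cB) (hα₀ : 0 < α₀) (hα₀1 : α₀ ≤ 1) (hα₂ : 0 < α₂)
    (hα₂q : α₂ ≤ 1 / 4) (hα₂α₁ : α₂ ≤ α₁) (h8 : 8 * α₂ < α₀) (hCπ : 0 ≤ Cπ) (hπn : ∀ X, ‖π X‖ ≤ Cπ * ‖X‖)
    (hπgc : ∀ X, π X ∈ 𝓜.gc) (hgcAd : ∀ g ∈ 𝓜.Gc, ∀ X ∈ 𝓜.gc, R g X ∈ 𝓜.gc) (heGc : ∀ a ∈ 𝓜.gc, expI c.ξ a ∈ 𝓜.Gc)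
    (hRP : ∀ f : Site P i → 𝔸, Rop f + Pop f = f)
    (hres : (2 + (P.d - 1) * (Cπ * (C311 1 + 2 * 1 ^ 14))) * α₂ ≤ α₀)
    (E : (PBond P i → 𝔸) × (PBond P i → 𝔸) → V)
    (hE : ∀ Φ ∈ space' 𝓜 F c α₀ α₁, AnalyticAt ℂ E ((fun b => (Φ.U b : 𝔸)), Φ.J))
    (hIV₁ : CondIV F.bg F.X₂ c α₀ (1 : PBond P i → 𝔸ˣ))
    (hIV : ∀ A ∈ space44 π Pop c.ξ α₂, CondIV F.bg F.X₂ c α₀ (sub310 c.ξ A (1 : PBond P i → 𝔸ˣ)))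
    {S B₃ W₀ : ℝ}
    (hS : ∀ w ∈ Metric.ball (0 : Cfg44 π Pop c.ξ (landauSub 𝓜 Rop c.ξ)) α₂,
      ‖E ((fun b => ((ofBackground π c.ξ (sub310 c.ξ w.val (1 : PBond P i → 𝔸ˣ))).U b : 𝔸)),
        (ofBackground π c.ξ (sub310 c.ξ w.val (1 : PBond P i → 𝔸ˣ))).J)‖ ≤ S)
    (hB : α₂ ≤ 2 * B₃) (hW0 : 0 ≤ W₀) (hW1 : W₀ ≤ 1)
    {H : W → Cfg44 π Pop c.ξ (landauSub 𝓜 Rop c.ξ)} {n : ℕ} (hH : ContDiffAt ℂ n H 0) (hH0 : H 0 = 0) (B : Fin n → W)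
    (out : Fin n → Prop) (i₀ : Fin n) (hi₀ : out i₀)
    (hv : ∀ (q : OrderedFinpartition n) (p : Fin q.length),
      ‖B12Repr43.blockIns (𝕜 := ℂ) H 0 B q p‖ ≤ B₃ * ∏ r, ‖B (q.emb p r)‖)
    (hvloc : ∀ (q : OrderedFinpartition n) (p : Fin q.length), (∃ r, out (q.emb p r)) →
      ‖B12Repr43.blockIns (𝕜 := ℂ) H 0 B q p‖ ≤ W₀ * (B₃ * ∏ r, ‖B (q.emb p r)‖)) :
    ‖iteratedFDeriv ℂ n (((fun A : PBond P i → 𝔸 =>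
      E ((fun b => ((ofBackground π c.ξ (sub310 c.ξ A (1 : PBond P i → 𝔸ˣ))).U b : 𝔸)),
        (ofBackground π c.ξ (sub310 c.ξ A (1 : PBond P i → 𝔸ˣ))).J)) ∘ Cfg44.incl π Pop c.ξ (landauSub 𝓜 Rop c.ξ)) ∘ H) 0 B‖
      ≤ (2 * (n : ℝ) ^ 2 * B₃ / α₂) ^ n * S * W₀ * ∏ j, ‖B j‖ :=
  B12Repr43.norm_iteratedFDeriv_comp_le Metric.isOpen_ball hα₂ subset_rfl
    (analyticOnNhd_E_sub310_one_ball 𝓜 hξ hξ1 hcB hα₀ hα₀1 hα₂ hα₂q hα₂α₁ h8 hCπ hπn hπgc hgcAd heGc hRP hres E hE hIV₁ hIV)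
    (fun w hw => hS w hw) hB hW0 hW1 hH hH0 B out i₀ hi₀ hv hvloc

end Ball

end

end Literature.MathematicalPhysics.QuantumFieldTheory.Balaban1983to89.B12Eq44Ball
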